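import Summits.Ventures.QEC.Census.AdditiveCertLanesCover
import HarnessLib

/-!
# `AddCert` lane replay, III: conclusions — `IsAdditiveCode`, exact `minDistance`, purity, existence (theorems only)

From `AddCert.reaches4_of_lanes` (`Census/AdditiveCertLanesCover.lean`) and the structural checks, exactly as in
type-02's `Census/AdditiveCertChunks.lean` (whose proofs are followed line by line with `Reaches4` supplied by the lane
engine): `isAdditiveCode_of_lanes`, `minDistance_code_of_lanes` (`k > 0`), `isPure_of_lanes` (empty allow-list),
`exists_stabilizer_weight_eq_of_structureL` (`k = 0` witness), `additiveCodeExists_of_lanes`,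
`pureAdditiveCodeExists_of_lanes`; assembly helpers `lanes_nil` / `lanes_cons` for the per-segment theorems of a data
file; control: the `[[5,1,3]]` certificate re-derived through one lane segment (tier KERNEL). USE in a census file, per
certificate literal `c` with segments `[(m₀,s₀), (m₁,s₁), …]` covering `[0, 3n)`:
`theorem hs : c.checkStructureL = true := by decide`, `theorem sᵢ : c.laneCheck mᵢ sᵢ fuel = true := by decide +kernel`,
then `c.isAdditiveCode_of_lanes segs fuel hs (by decide) (c.lanes_cons s₀ (c.lanes_cons s₁ (c.lanes_nil fuel)))`.
Standard axioms.
-/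

set_option autoImplicit false

namespace Summit.Ventures.QEC.Census

open Literature.InformationTheory.QuantumCodes Plane List

namespace AddCert

variable (c : AddCert)

/-! ## Conclusions (as in `AdditiveCertChunks`, from `checkStructure` + `Reaches4`) -/

/-- **Soundness (CRSS Thm. 1 form)**: structural checks + passing lane segments covering `[0, 3n)` ⇒
`[[n, n − |rows|, d]]`. -/
theorem isAdditiveCode_of_lanes (segs : List (ℕ × ℕ)) (fuel : ℕ) (hs : c.checkStructureL = true)
    (hcov : ∀ m < 3 * c.n, ∃ i < segs.length,
      (segs.getD i (0, 0)).1 ≤ m ∧ m < (segs.getD i (0, 0)).1 + (segs.getD i (0, 0)).2)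
    (hok : ∀ i < segs.length, c.laneCheck (segs.getD i (0, 0)).1 (segs.getD i (0, 0)).2 fuel = true) :
    IsAdditiveCode c.code c.k c.d := by
  have hrep := c.reaches4_of_lanes segs fuel hs hcov hok
  rw [checkStructureL, Bool.and_eq_true] at hs
  have hs' := hs.1
  simp only [checkStructure, Bool.and_eq_true, decide_eq_true_eq] at hs'
  obtain ⟨⟨⟨hcomm, hind⟩, hle⟩, hrest⟩ := hs'
  have hso := c.isSelfOrthogonal_code hcomm
  have hdim := c.finrank_code hind
  refine ⟨hso, by rw [hdim, k]; omega, ?_, ?_⟩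
  · by_cases hk : c.rows.length < c.n
    · rw [if_pos hk, Bool.and_eq_true] at hrest
      rw [allowList, if_pos hk] at hrep
      exact c.hasMinDist_of_reaches4 hrep (c.allow_mem_code hrest.2)
    · have hSS : sympDual c.code = c.code := by
        refine (Submodule.eq_of_le_of_finrank_le hso ?_).symm
        have := finrank_sympDual_add c.code
        omega
      intro w hw hw'
      exact absurd (hSS ▸ hw) hw'
  · intro hk0 v hv hv0
    have hk : ¬ c.rows.length < c.n := fun hlt => by simp [k] at hk0; omega
    rw [allowList, if_neg hk] at hrep
    by_contra hlt
    have hle' : sympWeight v ≤ c.d - 1 := by omega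
    have hleaf := c.leaf_of_reaches4 hrep v hle'
    have hwxz := ofBitPair_acc_suppSel c.n v
    rcases leaf_cases hleaf with hsyn | ⟨h1, h2⟩ | hmem
    · have := (c.mem_sympDual_code_iff (accX (suppSel c.n v), accZ (suppSel c.n v))).1
        (by rw [hwxz]; exact hso hv)
      rw [hsyn] at this
      exact Bool.false_ne_true this
    · apply hv0
      rw [← hwxz, h1, h2, ofBitPair_zero]
    · exact absurd hmem List.not_mem_nil

/-- **Soundness, `k > 0`**: the exact minimum distance. -/
theorem minDistance_code_of_lanes (segs : List (ℕ × ℕ)) (fuel : ℕ) (hs : c.checkStructureL = true)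
    (hcov : ∀ m < 3 * c.n, ∃ i < segs.length,
      (segs.getD i (0, 0)).1 ≤ m ∧ m < (segs.getD i (0, 0)).1 + (segs.getD i (0, 0)).2)
    (hok : ∀ i < segs.length, c.laneCheck (segs.getD i (0, 0)).1 (segs.getD i (0, 0)).2 fuel = true)
    (hk : c.rows.length < c.n) : minDistance c.code = c.d := by
  have hrep := c.reaches4_of_lanes segs fuel hs hcov hok
  rw [allowList, if_pos hk] at hrep
  rw [checkStructureL, Bool.and_eq_true] at hs
  have hs' := hs.1
  simp only [checkStructure, if_pos hk, Bool.and_eq_true, decide_eq_true_eq] at hs'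
  obtain ⟨⟨⟨-, -⟩, -⟩, hup, hfound⟩ := hs'
  simp only [upperOK, Bool.and_eq_true, beq_iff_eq] at hup
  obtain ⟨⟨⟨hsyn, hwt⟩, hnm⟩, hanti⟩ := hup
  refine minDistance_eq_of_witness ((c.mem_sympDual_code_iff c.witness).2 hsyn) ?_ ?_
    (c.hasMinDist_of_reaches4 hrep (c.allow_mem_code hfound))
  · intro hmem
    have hu := (c.mem_sympDual_code_iff c.nonmember).2 hnm
    have h0 : sympInner (ofBitPair c.n c.witness.1 c.witness.2)
        (ofBitPair c.n c.nonmember.1 c.nonmember.2) = 0 := (mem_sympDual_iff.1 hu) _ hmem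
    rw [sympInner_comm] at h0
    exact sympInner_ne_zero_of_sympParity_eq_one c.n hanti h0
  · rw [sympWeight_ofBitPair_eq_pw, hwt]

/-- **Purity, `k > 0` with empty allow-list**: no nonzero vector of `S̄⊥` below weight `d`. -/
theorem isPure_of_lanes (segs : List (ℕ × ℕ)) (fuel : ℕ) (hs : c.checkStructureL = true)
    (hcov : ∀ m < 3 * c.n, ∃ i < segs.length,
      (segs.getD i (0, 0)).1 ≤ m ∧ m < (segs.getD i (0, 0)).1 + (segs.getD i (0, 0)).2)
    (hok : ∀ i < segs.length, c.laneCheck (segs.getD i (0, 0)).1 (segs.getD i (0, 0)).2 fuel = true)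
    (hk : c.rows.length < c.n) (hf : c.found = []) : IsPure c.code c.d := by
  have hrep := c.reaches4_of_lanes segs fuel hs hcov hok
  rw [allowList, if_pos hk, hf, List.map_nil] at hrep
  intro w hw hw0
  by_contra hlt
  have hle : sympWeight w ≤ c.d - 1 := by omega
  have hleaf := c.leaf_of_reaches4 hrep w hle
  have hwxz := ofBitPair_acc_suppSel c.n w
  rcases leaf_cases hleaf with hsyn | ⟨h1, h2⟩ | hmem
  · have := (c.mem_sympDual_code_iff (accX (suppSel c.n w), accZ (suppSel c.n w))).1 (by rw [hwxz]; exact hw)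
    rw [hsyn] at this
    exact Bool.false_ne_true this
  · apply hw0
    rw [← hwxz, h1, h2, ofBitPair_zero]
  · exact absurd hmem List.not_mem_nil

/-- **`k = 0` exactness**: the certificate's witness is a stabilizer of weight exactly `d`. -/
theorem exists_stabilizer_weight_eq_of_structureL (hs : c.checkStructureL = true) (hk : ¬ c.rows.length < c.n) :
    ∃ v ∈ c.code, sympWeight v = c.d := by
  rw [checkStructureL, Bool.and_eq_true] at hs
  have hs' := hs.1
  simp only [checkStructure, if_neg hk, Bool.and_eq_true, decide_eq_true_eq, zeroOK, beq_iff_eq] at hs'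
  obtain ⟨-, hw, hwt⟩ := hs'
  refine ⟨ofBitPair c.n c.witness.1 c.witness.2, ?_, by rw [sympWeight_ofBitPair_eq_pw, hwt]⟩
  rw [← hw]
  exact c.ofBitPair_xorPairs_mem_code c.witnessCoef

/-- **The parameters are realised** (lane form): `[[n, n − |rows|, d]]` exists. -/
theorem additiveCodeExists_of_lanes (segs : List (ℕ × ℕ)) (fuel : ℕ) (hs : c.checkStructureL = true)
    (hcov : ∀ m < 3 * c.n, ∃ i < segs.length,
      (segs.getD i (0, 0)).1 ≤ m ∧ m < (segs.getD i (0, 0)).1 + (segs.getD i (0, 0)).2)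
    (hok : ∀ i < segs.length, c.laneCheck (segs.getD i (0, 0)).1 (segs.getD i (0, 0)).2 fuel = true) :
    AdditiveCodeExists c.n c.k c.d :=
  ⟨c.code, c.isAdditiveCode_of_lanes segs fuel hs hcov hok⟩

/-- **A PURE `[[n, n − |rows|, d]]` exists** (lane form, `k > 0`, empty allow-list). -/
theorem pureAdditiveCodeExists_of_lanes (segs : List (ℕ × ℕ)) (fuel : ℕ) (hs : c.checkStructureL = true)
    (hcov : ∀ m < 3 * c.n, ∃ i < segs.length,
      (segs.getD i (0, 0)).1 ≤ m ∧ m < (segs.getD i (0, 0)).1 + (segs.getD i (0, 0)).2)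
    (hok : ∀ i < segs.length, c.laneCheck (segs.getD i (0, 0)).1 (segs.getD i (0, 0)).2 fuel = true)
    (hk : c.rows.length < c.n) (hf : c.found = []) : PureAdditiveCodeExists c.n c.k c.d :=
  ⟨c.code, c.isAdditiveCode_of_lanes segs fuel hs hcov hok, c.isPure_of_lanes segs fuel hs hcov hok hk hf⟩

/-- Assembly helper: no segments left. -/
theorem lanes_nil (fuel : ℕ) :
    ∀ i < ([] : List (ℕ × ℕ)).length, c.laneCheck (([] : List (ℕ × ℕ)).getD i (0, 0)).1
      (([] : List (ℕ × ℕ)).getD i (0, 0)).2 fuel = true :=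
  fun i hi => absurd hi (Nat.not_lt_zero i)

/-- Assembly helper: one more passing segment in front. -/
theorem lanes_cons {fuel : ℕ} {p : ℕ × ℕ} {rest : List (ℕ × ℕ)} (h1 : c.laneCheck p.1 p.2 fuel = true)
    (h2 : ∀ i < rest.length, c.laneCheck (rest.getD i (0, 0)).1 (rest.getD i (0, 0)).2 fuel = true) :
    ∀ i < (p :: rest).length, c.laneCheck ((p :: rest).getD i (0, 0)).1 ((p :: rest).getD i (0, 0)).2 fuel = true := by
  intro i hi
  cases i with
  | zero => simpa using h1
  | succ i =>
    simp only [List.getD_cons_succ]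
    exact h2 i (by simpa using hi)

end AddCert

/-! ## Control: the `[[5,1,3]]` certificate through one lane segment -/

/-- Control: the `[[5,1,3]]` certificate of `AdditiveCertCheck.lean` passes the structural checks … -/
theorem checkStructureL_certC513 : certC513.checkStructureL = true := by decide

/-- … and its single lane segment (all selections of `≤ 2` of the 15 letter rows, 120 lanes). -/
theorem laneCheck_certC513 : certC513.laneCheck 0 15 0 = true := by decide +kernel

/-- Control: the `[[5,1,3]]` code is PURE to distance `3`, derived through the lane engine (tier KERNEL; the exact
distance `minDistance certC513.code = 3` is already in the tree twice, by `check` and by chunks). -/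
theorem isPure_certC513_lanes : IsPure certC513.code 3 :=
  certC513.isPure_of_lanes [(0, 15)] 0 checkStructureL_certC513 (by decide)
    (certC513.lanes_cons laneCheck_certC513 (certC513.lanes_nil 0)) (by decide) rfl

end Summit.Ventures.QEC.Census
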